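import Literature.Probability.Percolation.InterfaceTraversalBound
import HarnessLib

/-!
# No one-sided touching of a fixed line by the limit interface, part 1: distinct side pairs
in a HALF-annulus (one stretch and the boundary line)

Helper file for the registered stubs `stub_quadTransfer_noTouchRe` / `stub_quadTransfer_noTouchIm`
of line `hitting-tournament` of crux `LagHandOff` (stmt-CriticalPhenomena-10268), namespace
`Summit.CriticalPhenomena.CardyFormulaZ2.Cruxes.LagHandOff.HittingTournament`.

The tree's distinct-side-pairs lemma `IsMedialExploration.sidePair_ne`
(`InterfaceTraversalBound.lean`, Part I; Aizenman–Burchard 1999, App. A, "sectors") compares the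
side components of two darts of the exploration polygon in a full open annulus
`𝔸 = B(x, r₂) ∖ B̄(x, r₁)` minus the perturbed trace, and needs TWO stretches crossing the
annulus besides the dart to be separated.  For arms in a HALF-annulus (the input of half-plane
arm estimates, Lawler–Schramm–Werner 2002, App. A) one stretch suffices, the boundary line
playing the part of the second one: in

  `𝔸' = 𝔸 ∩ {z | Re (ū (z - x)) < h₁}`   (`‖u‖ = 1`, `0 < h₁ ≤ r₁`)

minus the trace, if a stretch of darts `I_b ∋ m_b` joins the inner disc to the outside of `𝔸`
and `m_a ∉ I_b`, with both side segments inside `𝔸'`, then the unordered pairs of side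
components of `m_a` and `m_b` differ (`sidePair_ne_half`).  Proof: close the stretch into a
loop through the outside of `B(x, r₂)`, the ray `x + [h₁, r₂] u` (which misses `𝔸'`) and the
inner disc; its crossing defect relative to the side segment of `m_b` is `±2πi`, relative to
that of `m_a` it is `0`, and winding numbers are constant on the components of `𝔸'` minus the
trace (`sidePairs_ne_of_wind`).  No Jordan curve theorem is used.

References: M. Aizenman, A. Burchard, Duke Math. J. 99 (1999), App. A; G. F. Lawler, O. Schramm,
W. Werner, Electron. J. Probab. 7 (2002), App. A (half-plane arm events).
-/

noncomputable section

open Set Metric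

namespace Summit.CriticalPhenomena.CardyFormulaZ2.Cruxes.LagHandOff.HittingTournament

open Literature.Probability.Percolation Literature.Probability.LatticeModels
open Literature.Probability.LatticeModels.IsMedialExploration

variable {D' : DiscreteDobrushin} {ω : BondConfig (Site 2)} {a : MedialVertex}
  {l : List MedialVertex}

/-- The height `Re (ū (z - x))` of `z` above the line through `x` orthogonal to the unit vector
`u` is `1`-Lipschitz: it changes by at most `dist z z'`. -/
theorem re_conj_mul_sub_le_dist {u : ℂ} (hu : ‖u‖ = 1) (x z z' : ℂ) :
    (starRingEnd ℂ u * (z - x)).re ≤ (starRingEnd ℂ u * (z' - x)).re + dist z z' := by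
  have h1 : (starRingEnd ℂ u * (z - x)).re - (starRingEnd ℂ u * (z' - x)).re =
      (starRingEnd ℂ u * (z - z')).re := by
    rw [← Complex.sub_re]; ring_nf
  have h2 : (starRingEnd ℂ u * (z - z')).re ≤ ‖starRingEnd ℂ u * (z - z')‖ := Complex.re_le_norm _
  rw [norm_mul, Complex.norm_conj, hu, one_mul, ← Complex.dist_eq] at h2
  linarith

/-- On the ray `x + t u`, `t` real, the height above the line is `t`. -/
theorem re_conj_mul_ray {u : ℂ} (hu : ‖u‖ = 1) (x : ℂ) (t : ℝ) :
    (starRingEnd ℂ u * (x + (t : ℂ) * u - x)).re = t := by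
  have h1 : starRingEnd ℂ u * u = 1 := by
    rw [Complex.conj_mul']
    simp [hu]
  have : starRingEnd ℂ u * (x + (t : ℂ) * u - x) = (t : ℂ) := by
    rw [add_sub_cancel_left, mul_left_comm, h1, mul_one]
  rw [this, Complex.ofReal_re]

/-- Points of the segment `[x + t₁ u, x + t₂ u]` (`t₁ ≤ t₂`) have height at least `t₁`. -/
theorem le_re_conj_mul_of_mem_segment_ray {u : ℂ} (hu : ‖u‖ = 1) (x : ℂ) {t₁ t₂ : ℝ}
    (ht : t₁ ≤ t₂) {z : ℂ} (hz : z ∈ segment ℝ (x + (t₂ : ℂ) * u) (x + (t₁ : ℂ) * u)) :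
    t₁ ≤ (starRingEnd ℂ u * (z - x)).re := by
  set f : ℂ → ℝ := fun w => (starRingEnd ℂ u * w).re with hf
  have hlin : IsLinearMap ℝ f :=
    { map_add := fun a b => by simp only [hf, mul_add, Complex.add_re]
      map_smul := fun c a => by
        simp only [hf, Complex.real_smul, smul_eq_mul]
        rw [mul_left_comm, Complex.re_ofReal_mul] }
  have hconv : Convex ℝ {w : ℂ | t₁ + f x ≤ f w} := convex_halfSpace_ge hlin _
  have hmem : ∀ t : ℝ, t₁ ≤ t → x + (t : ℂ) * u ∈ {w : ℂ | t₁ + f x ≤ f w} := by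
    intro t htt
    have h := re_conj_mul_ray hu x t
    show t₁ + (starRingEnd ℂ u * x).re ≤ (starRingEnd ℂ u * (x + (t : ℂ) * u)).re
    rw [mul_sub, Complex.sub_re] at h
    linarith
  have hz' := hconv.segment_subset (hmem t₂ ht) (hmem t₁ le_rfl) hz
  have h3 : (starRingEnd ℂ u * (z - x)).re = f z - f x := by
    simp only [hf, mul_sub, Complex.sub_re]
  rw [h3]
  have : t₁ + f x ≤ f z := hz'
  linarith

/-- **Distinct side pairs in a half-annulus.** In
`𝔸' = (B(x, r₂) ∖ B̄(x, r₁)) ∩ {z | Re (ū (z - x)) < h₁}` (`‖u‖ = 1`, `0 < h₁ ≤ r₁ < r₂`) minus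
the perturbed trace of the exploration polygon, consider the components of the left and right
points of two darts `mₐ`, `m_b` whose side segments lie in `𝔸'`. If the stretch of darts over
`I_b = [i_b, i_b + k_b] ∋ m_b` joins the inner disc `B̄(x, r₁)` to the outside of `B(x, r₂)` and
`mₐ ∉ I_b`, then the unordered pairs of side components of `mₐ` and of `m_b` differ: the loop
made of the stretch, a path outside `B(x, r₂)`, the ray `x + [h₁, r₂] u` and a path inside
`B̄(x, r₁)` misses `𝔸'`, has crossing defect `±2πi` relative to the side segment of `m_b` and
`0` relative to that of `mₐ`, and winding numbers are constant on components.
[cite: AizenmanBurchardDuke1999, Appendix A] -/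
theorem sidePair_ne_half (hexp : IsMedialExploration D' ω (a :: l)) (hδ : 0 < D'.δ) {x u : ℂ}
    (hu : ‖u‖ = 1) {r₁ r₂ h₁ : ℝ} (hr₁ : 0 < r₁) (hr₁₂ : r₁ < r₂) (hh₁ : 0 < h₁)
    (hh₁r : h₁ ≤ r₁) {ma mb ib kb : ℕ} (hma : ma < ((a :: l).zip l).length)
    (hb : ib + kb < ((a :: l).zip l).length) (hmb : ib ≤ mb ∧ mb ≤ ib + kb)
    (hma_b : ma < ib ∨ ib + kb < ma)
    (hSa : hexp.sideSeg ma ⊆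
      (ball x r₂ \ closedBall x r₁) ∩ {z | (starRingEnd ℂ u * (z - x)).re < h₁})
    (hSb : hexp.sideSeg mb ⊆
      (ball x r₂ \ closedBall x r₁) ∩ {z | (starRingEnd ℂ u * (z - x)).re < h₁})
    (hb_ends : (dist (hexp.pS ib) x ≤ r₁ ∧ r₂ ≤ dist (hexp.pT (ib + kb)) x) ∨
      (r₂ ≤ dist (hexp.pS ib) x ∧ dist (hexp.pT (ib + kb)) x ≤ r₁)) :
    s(connectedComponentIn (((ball x r₂ \ closedBall x r₁) ∩
          {z | (starRingEnd ℂ u * (z - x)).re < h₁}) \ hexp.pertTrace) (hexp.leftPt ma),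
        connectedComponentIn (((ball x r₂ \ closedBall x r₁) ∩
          {z | (starRingEnd ℂ u * (z - x)).re < h₁}) \ hexp.pertTrace) (hexp.rightPt ma)) ≠
      s(connectedComponentIn (((ball x r₂ \ closedBall x r₁) ∩
          {z | (starRingEnd ℂ u * (z - x)).re < h₁}) \ hexp.pertTrace) (hexp.leftPt mb),
        connectedComponentIn (((ball x r₂ \ closedBall x r₁) ∩
          {z | (starRingEnd ℂ u * (z - x)).re < h₁}) \ hexp.pertTrace) (hexp.rightPt mb)) := by
  have hr₂ : 0 < r₂ := hr₁.trans hr₁₂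
  have hmb' : mb < ((a :: l).zip l).length := by omega
  set A' : Set ℂ := (ball x r₂ \ closedBall x r₁) ∩ {z | (starRingEnd ℂ u * (z - x)).re < h₁}
    with hA'
  set X := A' \ hexp.pertTrace with hX
  -- the stretch
  obtain ⟨Pin, Pout, κ, hPin, hPout, hκ, hκne, hκze⟩ := hexp.exists_inout_path hδ hb hb_ends
  -- the connector: outside the disc, along the ray, inside the inner disc
  set Q₁ : ℂ := x + (r₂ : ℂ) * u with hQ₁
  set Q₂ : ℂ := x + (h₁ : ℂ) * u with hQ₂
  have hdistQ : ∀ t : ℝ, 0 ≤ t → dist (x + (t : ℂ) * u) x = t := fun t ht => by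
    rw [Complex.dist_eq, add_sub_cancel_left, norm_mul, Complex.norm_real, hu, mul_one,
      Real.norm_eq_abs, abs_of_nonneg ht]
  have hQ₁d : r₂ ≤ dist Q₁ x := by rw [hQ₁, hdistQ r₂ hr₂.le]
  have hQ₂d : dist Q₂ x ≤ r₁ := by rw [hQ₂, hdistQ h₁ hh₁.le]; exact hh₁r
  obtain ⟨γo, hγo⟩ := exists_path_outside hr₂ hPout hQ₁d
  obtain ⟨γi, hγi⟩ := exists_path_inside hQ₂d hPin
  set γl : Path Q₁ Q₂ := Path.segment Q₁ Q₂ with hγl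
  have hγl : ∀ t, h₁ ≤ (starRingEnd ℂ u * (γl t - x)).re := fun t => by
    have hmem : γl t ∈ range γl := ⟨t, rfl⟩
    rw [hγl, Path.range_segment] at hmem
    exact le_re_conj_mul_of_mem_segment_ray hu x (hh₁r.trans hr₁₂.le) hmem
  set loop : Path Pin Pin := κ.trans (γo.trans (γl.trans γi)) with hloop
  -- points of `A'` are off the three connectors
  have hoff : ∀ q ∈ A', (∀ t, γo t ≠ q) ∧ (∀ t, γl t ≠ q) ∧ (∀ t, γi t ≠ q) := by
    intro q hq
    obtain ⟨⟨hq1, hq2⟩, hq3⟩ := hq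
    rw [mem_ball] at hq1
    rw [mem_closedBall, not_le] at hq2
    have hq3' : (starRingEnd ℂ u * (q - x)).re < h₁ := hq3
    exact ⟨fun t h => by have := hγo t; rw [h] at this; linarith,
      fun t h => by have := hγl t; rw [h] at this; linarith,
      fun t h => by have := hγi t; rw [h] at this; linarith⟩
  -- crossing defect of the loop relative to a side segment inside `A'`
  have hcross : ∀ {m}, m < ((a :: l).zip l).length → hexp.sideSeg m ⊆ A' →
      loop.crossInc (hexp.leftPt m) (hexp.rightPt m) =
        κ.crossInc (hexp.leftPt m) (hexp.rightPt m) := by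
    intro m hm hS
    have hL : hexp.leftPt m ∈ hexp.sideSeg m := left_mem_segment _ _ _
    have hR : hexp.rightPt m ∈ hexp.sideSeg m := right_mem_segment _ _ _
    have hLt := hexp.leftPt_not_mem_pertTrace hδ hm
    have hRt := hexp.rightPt_not_mem_pertTrace hδ hm
    obtain ⟨hLo, hLl, hLi⟩ := hoff _ (hS hL)
    obtain ⟨hRo, hRl, hRi⟩ := hoff _ (hS hR)
    have hLκ : hexp.leftPt m ∉ range κ := fun h => hLt (hκ h)
    have hRκ : hexp.rightPt m ∉ range κ := fun h => hRt (hκ h)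
    have hLo' : hexp.leftPt m ∉ range γo := by rintro ⟨t, ht⟩; exact hLo t ht
    have hRo' : hexp.rightPt m ∉ range γo := by rintro ⟨t, ht⟩; exact hRo t ht
    have hLl' : hexp.leftPt m ∉ range γl := by rintro ⟨t, ht⟩; exact hLl t ht
    have hRl' : hexp.rightPt m ∉ range γl := by rintro ⟨t, ht⟩; exact hRl t ht
    have hLi' : hexp.leftPt m ∉ range γi := by rintro ⟨t, ht⟩; exact hLi t ht
    have hRi' : hexp.rightPt m ∉ range γi := by rintro ⟨t, ht⟩; exact hRi t ht
    rw [hloop, Path.crossInc_trans _ _ hLκ (by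
        rw [Path.trans_range, Path.trans_range]
        rintro (h | h | h); exacts [hLo' h, hLl' h, hLi' h]) hRκ (by
        rw [Path.trans_range, Path.trans_range]
        rintro (h | h | h); exacts [hRo' h, hRl' h, hRi' h]),
      Path.crossInc_trans _ _ hLo' (by
        rw [Path.trans_range]
        rintro (h | h); exacts [hLl' h, hLi' h]) hRo' (by
        rw [Path.trans_range]
        rintro (h | h); exacts [hRl' h, hRi' h]),
      Path.crossInc_trans _ _ hLl' hLi' hRl' hRi',
      Path.crossInc_eq_zero γo (fun t ht => (hoff _ (hS ht)).1 t rfl),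
      Path.crossInc_eq_zero γl (fun t ht => (hoff _ (hS ht)).2.1 t rfl),
      Path.crossInc_eq_zero γi (fun t ht => (hoff _ (hS ht)).2.2 t rfl)]
    ring
  -- side points are off the loop
  have hnotloop : ∀ {m}, m < ((a :: l).zip l).length → hexp.sideSeg m ⊆ A' →
      hexp.leftPt m ∉ range loop ∧ hexp.rightPt m ∉ range loop := by
    intro m hm hS
    have aux : ∀ q ∈ hexp.sideSeg m, q ∉ hexp.pertTrace → q ∉ range loop := by
      intro q hq hqt h
      rw [hloop, Path.trans_range, Path.trans_range, Path.trans_range] at h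
      rcases h with h | ⟨t, rfl⟩ | ⟨t, rfl⟩ | ⟨t, rfl⟩
      · exact hqt (hκ h)
      · exact (hoff _ (hS hq)).1 t rfl
      · exact (hoff _ (hS hq)).2.1 t rfl
      · exact (hoff _ (hS hq)).2.2 t rfl
    exact ⟨aux _ (left_mem_segment _ _ _) (hexp.leftPt_not_mem_pertTrace hδ hm),
      aux _ (right_mem_segment _ _ _) (hexp.rightPt_not_mem_pertTrace hδ hm)⟩
  -- winding numbers: different at the two sides of `m_b`, equal at the two sides of `mₐ`
  have hpi : (2 * Real.pi * Complex.I : ℂ) ≠ 0 := by simp [Real.pi_ne_zero, Complex.I_ne_zero]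
  have hwb : Literature.Topology.PlaneTopology.wind (fun t => loop.extend t - hexp.leftPt mb) ≠
      Literature.Topology.PlaneTopology.wind (fun t => loop.extend t - hexp.rightPt mb) := by
    intro h
    have := Path.crossInc_loop loop (hnotloop hmb' hSb).1 (hnotloop hmb' hSb).2
    rw [h, sub_self, zero_mul, hcross hmb' hSb] at this
    exact hκne mb hmb.1 hmb.2 this
  have hwa : Literature.Topology.PlaneTopology.wind (fun t => loop.extend t - hexp.leftPt ma) =
      Literature.Topology.PlaneTopology.wind (fun t => loop.extend t - hexp.rightPt ma) := by
    have := Path.crossInc_loop loop (hnotloop hma hSa).1 (hnotloop hma hSa).2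
    rw [hcross hma hSa, hκze ma hma hma_b] at this
    have h0 := (mul_eq_zero.1 this.symm).resolve_right hpi
    have h1 : ((Literature.Topology.PlaneTopology.wind fun t => loop.extend t - hexp.leftPt ma : ℤ) : ℂ) =
        (Literature.Topology.PlaneTopology.wind fun t => loop.extend t - hexp.rightPt ma : ℤ) := by
      rw [sub_eq_zero] at h0; exact_mod_cast h0
    exact_mod_cast h1
  -- components of `X` avoid the loop
  have hK : IsClosed (range loop) := (isCompact_range loop.continuous).isClosed
  have hXK : X ⊆ (range loop)ᶜ := by
    intro z hz hzl
    obtain ⟨hzA, hzt⟩ := hz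
    rw [hloop, Path.trans_range, Path.trans_range, Path.trans_range] at hzl
    rcases hzl with h | ⟨t, rfl⟩ | ⟨t, rfl⟩ | ⟨t, rfl⟩
    · exact hzt (hκ h)
    · exact (hoff _ hzA).1 t rfl
    · exact (hoff _ hzA).2.1 t rfl
    · exact (hoff _ hzA).2.2 t rfl
  have hLa := hexp.leftPt_not_mem_pertTrace hδ hma
  have hRa := hexp.rightPt_not_mem_pertTrace hδ hma
  have hℓa : hexp.leftPt ma ∈ X := ⟨hSa (left_mem_segment _ _ _), hLa⟩
  have hra : hexp.rightPt ma ∈ X := ⟨hSa (right_mem_segment _ _ _), hRa⟩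
  obtain ⟨h1, h2⟩ :=
    Literature.Topology.PlaneTopology.sidePairs_ne_of_wind loop hK subset_rfl hXK hℓa hra hwa hwb
  intro h
  rw [Sym2.eq_iff] at h
  rcases h with ⟨h3, h4⟩ | ⟨h3, h4⟩
  · exact h1 ⟨h3, h4⟩
  · exact h2 ⟨h3, h4⟩

/-- **Registered sub-stub `stub_noTouch_sidePairHalf`** (line `hitting-tournament`, stubs
`stub_quadTransfer_noTouchRe` / `stub_quadTransfer_noTouchIm`, helper 1): `sidePair_ne_half` with
all arguments explicit. [cite: AizenmanBurchardDuke1999, Appendix A] -/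
theorem stub_noTouch_sidePairHalf : ∀ (D' : DiscreteDobrushin) (ω : BondConfig (Site 2)) (a : MedialVertex) (l : List MedialVertex) (hexp : IsMedialExploration D' ω (a :: l)), 0 < D'.δ → ∀ (x u : ℂ), ‖u‖ = 1 → ∀ (r₁ r₂ h₁ : ℝ), 0 < r₁ → r₁ < r₂ → 0 < h₁ → h₁ ≤ r₁ → ∀ (ma mb ib kb : ℕ), ma < ((a :: l).zip l).length → ib + kb < ((a :: l).zip l).length → ib ≤ mb ∧ mb ≤ ib + kb → (ma < ib ∨ ib + kb < ma) → hexp.sideSeg ma ⊆ (Metric.ball x r₂ \ Metric.closedBall x r₁) ∩ {z | (starRingEnd ℂ u * (z - x)).re < h₁} → hexp.sideSeg mb ⊆ (Metric.ball x r₂ \ Metric.closedBall x r₁) ∩ {z | (starRingEnd ℂ u * (z - x)).re < h₁} → ((dist (hexp.pS ib) x ≤ r₁ ∧ r₂ ≤ dist (hexp.pT (ib + kb)) x) ∨ (r₂ ≤ dist (hexp.pS ib) x ∧ dist (hexp.pT (ib + kb)) x ≤ r₁)) → s(connectedComponentIn (((Metric.ball x r₂ \ Metric.closedBall x r₁) ∩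 {z | (starRingEnd ℂ u * (z - x)).re < h₁}) \ hexp.pertTrace) (hexp.leftPt ma), connectedComponentIn (((Metric.ball x r₂ \ Metric.closedBall x r₁) ∩ {z | (starRingEnd ℂ u * (z - x)).re < h₁}) \ hexp.pertTrace) (hexp.rightPt ma)) ≠ s(connectedComponentIn (((Metric.ball x r₂ \ Metric.closedBall x r₁) ∩ {z | (starRingEnd ℂ u * (z - x)).re < h₁}) \ hexp.pertTrace) (hexp.leftPt mb), connectedComponentIn (((Metric.ball x r₂ \ Metric.closedBall x r₁) ∩ {z | (starRingEnd ℂ u * (z - x)).re < h₁}) \ hexp.pertTrace) (hexp.rightPt mb)) :=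
  fun _ _ _ _ hexp hδ _ _ hu _ _ _ hr₁ hr₁₂ hh₁ hh₁r _ _ _ _ hma hb hmb hma_b hSa hSb hb_ends =>
    sidePair_ne_half hexp hδ hu hr₁ hr₁₂ hh₁ hh₁r hma hb hmb hma_b hSa hSb hb_ends

end Summit.CriticalPhenomena.CardyFormulaZ2.Cruxes.LagHandOff.HittingTournament

end
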